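import Summits.QuantumFields.YangMills.Theorems.BalabanUVNodesPortU8ImagesNear
import Summits.QuantumFields.YangMills.Theorems.BalabanUVNodesPortU8TwoVolumeRowCapped
import Summits.QuantumFields.YangMills.Theorems.BalabanUVNodesPortU8LocUnivDecayClause3

/-!
# Port piece U8 — THE METHOD OF IMAGES, FILE 4b: ★★★ THE NEAR″ CLAUSES OF THE TWO-VOLUME DIFFERENCE `E = HrLocξ_{K+1}(univ) ∘ lift − HrLocξ_K(univ)` WITHOUT ANY WINDOW:
# on a bond whose block lies in the window of radius `R` about the label (no wrap), the four token stencils of `E` are `≤ A·η^j·e^{−δ·N_K/4}` — two TAILS of the periodised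
# infinite-lattice kernels (files 1–4a), `A, δ` depending on the family only (PORT-PLAN-v4 §4)

Cell `ym-nodeO-ideate` ∕ `ym-balaban-port`, porter `ymgap-nodeO-port-PTB-1` (gen 5).  JOIN-side helper for **stmt-QuantumFields-27238** (K0ᴬ), `--supports … --as helper`.
[B5] = [Balaban1984PropagatorsI], [I] = [Balaban1987RG1], [15] = [Balaban1985Variational].  This replaces the NEAR branch of ✓`sandwich_clauses_capped` (which consumed the displayed
(Tok-cmpU-cap) caps + window transport) by the method of images: NO window, NO cap, NO token.

WHAT IS PROVED (kernel, sorry-free).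
§1 `E`'s stencils factor through the scalar response: `stencilE_value∕diff∕lap∕curl_eq_smul` — each token stencil of `E` at a bond `β` of an off-wrap domain is
   `(η·(S_τW_{K+1}(lift β) − S_τW_K(β)) : ℂ) • ρ₈(bV a)` (✓`stencil_commute_of_mem_domBonds`).
§2 ★★★ `images_near_clauses` — `∃ δ > 0, A ≥ 0` (family constants: file 3's rows and file 1's tail constants) such that for every fill, member `K ≥ K₀`, colour, N-slot label
   `(μ, z)` with `2(|z_i| + R) < N_K`, off-wrap domain `X`, bond `β ∈ domBonds X` with `coarsenTo (k+1) β₋ ∈ recordWindow R (−z)`: the four stencils of `E` at `β` are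
   `≤ A·η^{j}·e^{−δ·N_K}`, `j = 1, 2, 3, 3`, `N_K = sitesPerDir (k+1)`.

HONEST FRAMING.  Bookkeeping over PROVED tree theorems; nothing of Bałaban asserted beyond the cited rows; 27931 CLOSED·IMPLICATION-ONLY·IN TOTO unchanged; K0ᴬ 27238 OPEN; NODE O 0∕1;
COUNT 8∕28 · K 1∕4 UNMOVED; finite `𝕋⁴_{L^K}` at fixed ε — NOT continuum ∕ OS ∕ Clay; **the Yang–Mills mass gap (Clay) is NOT proved.**
-/

noncomputable section

open scoped BigOperators

namespace Summit.QuantumFields.YangMills.Theorems.PortU8.Images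

open Literature.MathematicalPhysics.QuantumFieldTheory.Balaban1983to89
open Literature.MathematicalPhysics.QuantumFieldTheory.Balaban1983to89.Node00
open Literature.MathematicalPhysics.QuantumFieldTheory.Balaban1983to89.T4Continuum (T4Family)
open Literature.MathematicalPhysics.QuantumFieldTheory.Balaban1983to89.B4ContourShift (supNorm)
open Literature.MathematicalPhysics.QuantumFieldTheory.Balaban1983to89.B4TorusKernel (periodConst)
open Literature.MathematicalPhysics.QuantumFieldTheory.Balaban1983to89.B4TorusKernel.MultiPeriod (translate translate_apply)
open Literature.MathematicalPhysics.QuantumFieldTheory.Balaban1983to89.B5Hk163Decay (MG163 MG163_nonneg)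
open Literature.MathematicalPhysics.QuantumFieldTheory.Balaban1983to89.B5Hk163Strip (kappa163 kappa163_pos)
open Literature.MathematicalPhysics.QuantumFieldTheory.Balaban1983to89.B5Hk163TorusHolderDecay (MD163)
open Literature.MathematicalPhysics.QuantumFieldTheory.Balaban1983to89.B5Prop11Plancherel (Tor fine)
open Literature.MathematicalPhysics.QuantumFieldTheory.Balaban1983to89.B5Eq117TorusCarriers (Mk EK)
open Literature.MathematicalPhysics.QuantumFieldTheory.Balaban1983to89.B5Eq118OneStroke (iterBlockOf)
open Literature.MathematicalPhysics.QuantumFieldTheory.Balaban1983to89.B6LowerBound2153Torus (toT rep)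
open Literature.MathematicalPhysics.QuantumFieldTheory.Balaban1983to89.B6BondElimination (unitVec unitVec_apply)
open Summit.QuantumFields.YangMills.Theorems.K0RecordFormatNames
open Summit.QuantumFields.YangMills.Theorems.PortU8

variable (F : T4Family)

/-! ## §1  The stencils of `E` factor through the scalar response -/

section Smul

variable (a₀ ε₂₉ : ℝ) {k K : ℕ}

/-- The colour wrapper: `HrLocξ W a l b = (ξ·windowResp W l b : ℂ) • ρ₈(bV a)`. [cite: Balaban1987RG1, (3.37) p.277 (bookkeeping)] -/
theorem recordHrLocξ_eq_smul (K' : ℕ) (W : Finset (Site (F.P K') (k + 1))) (a : (thetaFill F a₀ ε₂₉).ιβ) (l : RespLabel F k K') (b : PBond (F.P K') 0) :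
    letI θ := thetaFill F a₀ ε₂₉; letI := θ.instVβ₁; letI := θ.instVβ₂; letI := θ.instιβ
    recordHrLocξ F θ k K' W a l b = (((F.P K').eta (k + 1) * windowResp F k K' W l b : ℝ) : ℂ) • (fun i i' : Fin 2 => θ.ρ8 (θ.bV a) i i') := by
  funext i i'
  simp only [recordHrLocξ, windowRespξ, Pi.smul_apply, smul_eq_mul, Complex.ofReal_mul]

/-- **THE FOUR STENCILS OF `E = Hr_{K+1} ∘ lift − Hr_K` FACTOR**: at a bond `⟨x, d⟩` where the centred lift commutes with the stencil steps (`hsh`, `hun`, `hus`), each token stencil of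
`E` is `(ξ·(stencil of W_{K+1} at ⟨lift x, d⟩ − stencil of W_K at ⟨x, d⟩) : ℂ) • ρ₈(bV a)` (`ξ_{K+1} = ξ_K`). [cite: Balaban1987RG1, (1.21) p.264, (3.37) p.277 (bookkeeping); Balaban1985Variational, (190) p.308] -/
theorem stencilE_eq_smul (a : (thetaFill F a₀ ε₂₉).ιβ) (lK : RespLabel F k K) (lK1 : RespLabel F k (K + 1))
    (x : Site (F.P K) 0) (dir : Fin (F.P K).d)
    (hsh : ∀ ν : Fin (F.P K).d, (liftSiteCtr F K 0 x).shift ν = liftSiteCtr F K 0 (x.shift ν))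
    (hun : ∀ ν : Fin (F.P K).d, (liftSiteCtr F K 0 x).unshift ν = liftSiteCtr F K 0 (x.unshift ν))
    (hus : ∀ ν μ' : Fin (F.P K).d, (liftSiteCtr F K 0 (x.unshift ν)).shift μ' = liftSiteCtr F K 0 ((x.unshift ν).shift μ')) :
    letI θ := thetaFill F a₀ ε₂₉; letI := θ.instVβ₁; letI := θ.instVβ₂; letI := θ.instιβ
    letI E : PBond (F.P K) 0 → Fin 2 → Fin 2 → ℂ := fun b' => recordHrLocξ F θ k (K + 1) Finset.univ a lK1 (liftBondCtr F K 0 b') - recordHrLocξ F θ k K Finset.univ a lK b'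
    letI W : PBond (F.P K) 0 → ℝ := windowResp F k K Finset.univ lK
    letI W' : PBond (F.P (K + 1)) 0 → ℝ := windowResp F k (K + 1) Finset.univ lK1
    letI x' : Site (F.P (K + 1)) 0 := liftSiteCtr F K 0 x
    letI ρ : Fin 2 → Fin 2 → ℂ := fun i i' => θ.ρ8 (θ.bV a) i i'
    letI ξ : ℝ := (F.P K).eta (k + 1)
    E ⟨x, dir⟩ = ((ξ * (W' ⟨x', dir⟩ - W ⟨x, dir⟩) : ℝ) : ℂ) • ρ ∧
    (∀ ν : Fin (F.P K).d, E ⟨x.shift ν, dir⟩ - E ⟨x, dir⟩ = ((ξ * ((W' ⟨x'.shift ν, dir⟩ - W' ⟨x', dir⟩) - (W ⟨x.shift ν, dir⟩ - W ⟨x, dir⟩)) : ℝ) : ℂ) • ρ) ∧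
    (∑ ν : Fin (F.P K).d, (E ⟨x.shift ν, dir⟩ - (2 : ℂ) • E ⟨x, dir⟩ + E ⟨x.unshift ν, dir⟩)) =
      ((ξ * ((∑ ν : Fin (F.P K).d, (W' ⟨x'.shift ν, dir⟩ - 2 * W' ⟨x', dir⟩ + W' ⟨x'.unshift ν, dir⟩)) -
        (∑ ν : Fin (F.P K).d, (W ⟨x.shift ν, dir⟩ - 2 * W ⟨x, dir⟩ + W ⟨x.unshift ν, dir⟩))) : ℝ) : ℂ) • ρ ∧
    (∑ ν : Fin (F.P K).d, ((E ⟨x, dir⟩ + E ⟨x.shift dir, ν⟩ - E ⟨x.shift ν, dir⟩ - E ⟨x, ν⟩) -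
      (E ⟨x.unshift ν, dir⟩ + E ⟨(x.unshift ν).shift dir, ν⟩ - E ⟨(x.unshift ν).shift ν, dir⟩ - E ⟨x.unshift ν, ν⟩))) =
      ((ξ * ((∑ ν : Fin (F.P K).d, ((W' ⟨x', dir⟩ + W' ⟨x'.shift dir, ν⟩ - W' ⟨x'.shift ν, dir⟩ - W' ⟨x', ν⟩) -
          (W' ⟨x'.unshift ν, dir⟩ + W' ⟨(x'.unshift ν).shift dir, ν⟩ - W' ⟨(x'.unshift ν).shift ν, dir⟩ - W' ⟨x'.unshift ν, ν⟩))) -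
        (∑ ν : Fin (F.P K).d, ((W ⟨x, dir⟩ + W ⟨x.shift dir, ν⟩ - W ⟨x.shift ν, dir⟩ - W ⟨x, ν⟩) -
          (W ⟨x.unshift ν, dir⟩ + W ⟨(x.unshift ν).shift dir, ν⟩ - W ⟨(x.unshift ν).shift ν, dir⟩ - W ⟨x.unshift ν, ν⟩)))) : ℝ) : ℂ) • ρ := by
  letI θ := thetaFill F a₀ ε₂₉; letI := θ.instVβ₁; letI := θ.instVβ₂; letI := θ.instιβ
  have heta : (F.P (K + 1)).eta (k + 1) = (F.P K).eta (k + 1) := rfl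
  simp only [liftBondCtr, ← hsh, ← hun, ← hus, recordHrLocξ_eq_smul, heta]
  refine ⟨?_, fun ν => ?_, ?_, ?_⟩
  · rw [← sub_smul]
    congr 1; push_cast; ring
  · simp only [← sub_smul]
    congr 1; push_cast; ring
  · simp only [smul_smul, ← sub_smul, ← add_smul, ← Finset.sum_smul]
    congr 1; push_cast
    simp only [Finset.mul_sum, ← Finset.sum_sub_distrib]
    exact Finset.sum_congr rfl fun ν _ => by ring
  · simp only [← sub_smul, ← add_smul, ← Finset.sum_smul]
    congr 1; push_cast
    simp only [Finset.mul_sum, ← Finset.sum_sub_distrib]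
    exact Finset.sum_congr rfl fun ν _ => by ring

end Smul

/-! ## §2  Summability of the stencil kernels in offset form -/

section OffsetSummable

variable (n : ℕ) [NeZero n] {N : Fin (3 + 1) → ℕ}

/-- Summability of `m ↦ 𝓚(a + n·(x + N∘m))`. [cite: Balaban1984PropagatorsI, (1.65) p.29] -/
theorem summable_imgKer_offset (hN : ∀ i, 1 ≤ N i) (μ lam : Fin (3 + 1)) (a : Fin (3 + 1) → Fin n) (x : Fin (3 + 1) → ℤ) :
    Summable (fun m : Fin (3 + 1) → ℤ => imgKer n μ lam ((fun j => ((a j : ℕ) : ℤ)) + (n : ℤ) • translate N x m)) :=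
  (summable_imgKer_translate_offset n N hN μ lam a x 0 abs_zero_step_le).congr fun m => by rw [add_zero]

/-- Summability of the first-difference kernel along `a + n·(x + N∘m)`. [cite: Balaban1984PropagatorsI, (1.65) p.29; Balaban1985Variational, (190) p.308] -/
theorem summable_kerDiff_offset (hN : ∀ i, 1 ≤ N i) (μ lam ν : Fin (3 + 1)) (a : Fin (3 + 1) → Fin n) (x : Fin (3 + 1) → ℤ) :
    Summable (fun m : Fin (3 + 1) → ℤ => kerDiff n μ lam ν ((fun j => ((a j : ℕ) : ℤ)) + (n : ℤ) • translate N x m)) := by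
  have S := fun (s : Fin (3 + 1) → ℤ) (hs : ∀ i, |s i| ≤ 2) => summable_imgKer_translate_offset n N hN μ lam a x s hs
  refine ((S (unitVec ν) fun i => (abs_unitVec_le ν i).1).sub (S 0 abs_zero_step_le)).congr fun m => ?_
  simp only [kerDiff, add_zero]

/-- Summability of the Laplacian kernel along `a + n·(x + N∘m)`. [cite: Balaban1984PropagatorsI, (1.65) p.29; Balaban1985Variational, (190) p.308] -/
theorem summable_kerLap_offset (hN : ∀ i, 1 ≤ N i) (μ lam : Fin (3 + 1)) (a : Fin (3 + 1) → Fin n) (x : Fin (3 + 1) → ℤ) :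
    Summable (fun m : Fin (3 + 1) → ℤ => kerLap n μ lam ((fun j => ((a j : ℕ) : ℤ)) + (n : ℤ) • translate N x m)) := by
  have S := fun (s : Fin (3 + 1) → ℤ) (hs : ∀ i, |s i| ≤ 2) => summable_imgKer_translate_offset n N hN μ lam a x s hs
  refine (summable_sum (s := (Finset.univ : Finset (Fin (3 + 1)))) fun ν _ =>
    ((S (unitVec ν) fun i => (abs_unitVec_le ν i).1).sub ((S 0 abs_zero_step_le).mul_left 2)).add
      (S (-unitVec ν) fun i => (abs_unitVec_le ν i).2)).congr fun m => ?_
  simp only [kerLap, add_zero]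
  simp only [sub_eq_add_neg]

/-- Summability of the curl kernel along `a + n·(x + N∘m)`. [cite: Balaban1984PropagatorsI, (1.65) p.29; Balaban1985Variational, (190) p.308] -/
theorem summable_kerCurl_offset (hN : ∀ i, 1 ≤ N i) (μ lam : Fin (3 + 1)) (a : Fin (3 + 1) → Fin n) (x : Fin (3 + 1) → ℤ) :
    Summable (fun m : Fin (3 + 1) → ℤ => kerCurl n μ lam ((fun j => ((a j : ℕ) : ℤ)) + (n : ℤ) • translate N x m)) := by
  have S := fun (μ' : Fin (3 + 1)) (s : Fin (3 + 1) → ℤ) (hs : ∀ i, |s i| ≤ 2) => summable_imgKer_translate_offset n N hN μ' lam a x s hs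
  have s0 : ∀ i : Fin (3 + 1), |(0 : Fin (3 + 1) → ℤ) i| ≤ 2 := abs_zero_step_le
  have s1 : ∀ ν i : Fin (3 + 1), |unitVec ν i| ≤ 2 := fun ν i => (abs_unitVec_le ν i).1
  have s2 : ∀ ν i : Fin (3 + 1), |(-unitVec ν) i| ≤ 2 := fun ν i => (abs_unitVec_le ν i).2
  have s3 : ∀ ν i : Fin (3 + 1), |(-unitVec ν + unitVec μ) i| ≤ 2 := fun ν i => (abs_unitVec_add_le ν μ i).1
  have s4 : ∀ ν i : Fin (3 + 1), |(-unitVec ν + unitVec ν) i| ≤ 2 := fun ν i => (abs_unitVec_add_le ν ν i).2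
  refine (summable_sum (s := (Finset.univ : Finset (Fin (3 + 1)))) fun ν _ =>
    ((((S μ 0 s0).add (S ν _ (s1 μ))).sub (S μ _ (s1 ν))).sub (S ν 0 s0)).sub
      ((((S μ _ (s2 ν)).add (S ν _ (s3 ν))).sub (S μ _ (s4 ν))).sub (S ν _ (s2 ν)))).congr fun m => ?_
  simp only [kerCurl, add_zero]
  simp only [sub_eq_add_neg, add_assoc]

end OffsetSummable

/-! ## §3  ★★★ The NEAR″ clauses -/

/-- Bookkeeping: `‖(c : ℂ) • ρ‖ ≤ |c|` for `‖ρ‖ ≤ 1`. [folklore] -/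
theorem norm_real_smul_le {c : ℝ} {ρ : Fin 2 → Fin 2 → ℂ} (hρ : ‖ρ‖ ≤ 1) : ‖((c : ℝ) : ℂ) • ρ‖ ≤ |c| := by
  rw [norm_smul, Complex.norm_real, Real.norm_eq_abs]
  exact mul_le_of_le_one_right (abs_nonneg c) hρ

/-- Bookkeeping for the four clauses: `ξ·(2·(m·C·e)) ≤ (2·Σ·e′)·ξ` when `m·C ≤ Σ`, `e ≤ e′`. [folklore] -/
theorem clause_arith {ξ m C e e' S : ℝ} (hξ : 0 ≤ ξ) (hmC : m * C ≤ S) (hm : 0 ≤ m * C) (he : e ≤ e') (he0 : 0 ≤ e) :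
    ξ * (2 * (m * C * e)) ≤ 2 * S * e' * ξ := by
  have h1 : m * C * e ≤ S * e' := by
    calc m * C * e ≤ m * C * e' := mul_le_mul_of_nonneg_left he hm
      _ ≤ S * e' := mul_le_mul_of_nonneg_right hmC (he0.trans he)
  nlinarith

/-- ★★★ **THE NEAR″ CLAUSES OF THE TWO-VOLUME DIFFERENCE, BY THE METHOD OF IMAGES — NO WINDOW, NO CAP, NO TOKEN.**  There are `δ > 0`, `A ≥ 0` depending on the family
only such that for every fill `(a₀, ε₂₉)`, guard `Mc`, step `k`, member `K ≥ K₀`, colour `a`, N-slot label `(μ, z)` and radius `R` with the no-reach condition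
`2(|z_i| + R) < N_K`, every off-wrap domain `X` and bond `β ∈ domBonds X` whose block lies in the window of radius `R` about the label: with
`E = HrLocξ_{K+1}(univ) ∘ lift − HrLocξ_K(univ)` and `B = A·e^{−δ·N_K}` (`N_K = sitesPerDir (k+1)`),
`‖E β‖ ≤ B·η`, `‖∇E β‖ ≤ B·η²`, `‖ΔE β‖ ≤ B·η³`, `‖∂*∂E β‖ ≤ B·η³`.  Proof: §1 reduces each stencil to the scalar two-volume difference; files 2b express both
volumes' stencils as periodisations of the SAME infinite-lattice stencil kernel over the two period lattices; file 4a bounds the difference by two tails using the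
infinite-volume kernel rows of file 3 (which carry the `η^{j−1}`) and file 1's tail constant. [cite: Balaban1984PropagatorsI, p.36 ll.20–23, (1.63) p.28, (1.65) p.29;
Balaban1987RG1, (1.21) p.264, p.275 L5–8; Balaban1985Variational, (190) p.308] -/
theorem images_near_clauses :
    ∃ δ : ℝ, 0 < δ ∧ ∃ A : ℝ, 0 ≤ A ∧ ∀ (a₀ ε₂₉ : ℝ) (Mc k K : ℕ), McGuard F Mc → recordK₀ F Mc k ≤ K →
      ∀ (a : (thetaFill F a₀ ε₂₉).ιβ) (μ : Fin 4) (z : Fin 4 → ℤ) (R : ℕ), (∀ i, 2 * (|(-z) i| + R) < ((F.P K).sitesPerDir (k + 1) : ℤ)) →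
      ∀ {X : (recordDomSys F Mc k K).Dom}, X ∉ recordWrapCtr F Mc k K → ∀ {β : PBond (F.P K) 0}, β ∈ domBonds F Mc k K X →
      coarsenTo (k + 1) β.src ∈ recordWindow F k K R (-z) →
      letI θ := thetaFill F a₀ ε₂₉; letI := θ.instVβ₁; letI := θ.instVβ₂; letI := θ.instιβ
      letI E : PBond (F.P K) 0 → Fin 2 → Fin 2 → ℂ := fun b' =>
        recordHrLocξ F θ k (K + 1) Finset.univ a (recordE F k (K + 1) μ z) (liftBondCtr F K 0 b') - recordHrLocξ F θ k K Finset.univ a (recordE F k K μ z) b'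
      letI B : ℝ := A * Real.exp (-(δ * ((F.P K).sitesPerDir (k + 1) : ℝ)))
      ‖E ⟨β.src, β.dir⟩‖ ≤ B * (F.P K).eta (k + 1) ∧
      (∀ ν : Fin (F.P K).d, ‖E ⟨β.src.shift ν, β.dir⟩ - E ⟨β.src, β.dir⟩‖ ≤ B * (F.P K).eta (k + 1) ^ 2) ∧
      ‖∑ ν : Fin (F.P K).d, (E ⟨β.src.shift ν, β.dir⟩ - (2 : ℂ) • E ⟨β.src, β.dir⟩ + E ⟨β.src.unshift ν, β.dir⟩)‖ ≤ B * (F.P K).eta (k + 1) ^ 3 ∧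
      ‖∑ ν : Fin (F.P K).d, ((E ⟨β.src, β.dir⟩ + E ⟨β.src.shift β.dir, ν⟩ - E ⟨β.src.shift ν, β.dir⟩ - E ⟨β.src, ν⟩) -
        (E ⟨β.src.unshift ν, β.dir⟩ + E ⟨(β.src.unshift ν).shift β.dir, ν⟩ - E ⟨(β.src.unshift ν).shift ν, β.dir⟩ - E ⟨β.src.unshift ν, ν⟩))‖ ≤
        B * (F.P K).eta (k + 1) ^ 3 := by
  -- FAMILY CONSTANTS: the three infinite-volume kernel rows (file 3) and their tail constants (file 1)
  have hκ₀ : 0 < kappa163 4 / (((3 : ℕ) : ℝ) + 1) := div_pos (kappa163_pos 4) (by norm_num)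
  obtain ⟨Ct₀, hCt₀0, hCt₀⟩ := exists_tailConst 3 hκ₀
  obtain ⟨δ₂, hδ₂, C₂, hC₂0, hLap⟩ := norm_re_kerLap_le F
  obtain ⟨Ct₂, hCt₂0, hCt₂⟩ := exists_tailConst 3 hδ₂
  obtain ⟨δ₃, hδ₃, C₃, hC₃0, hCurl⟩ := norm_re_kerCurl_le F
  obtain ⟨Ct₃, hCt₃0, hCt₃⟩ := exists_tailConst 3 hδ₃
  set M₀ : ℝ := MG163 4 * periodConst (kappa163 4) 3 with hM₀
  set M₁ : ℝ := MD163 4 * periodConst (kappa163 4) 3 with hM₁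
  set S : ℝ := |M₀| * Ct₀ + |M₁| * Ct₀ + C₂ * Ct₂ + C₃ * Ct₃ with hS_def
  have hS0 : 0 ≤ |M₀| * Ct₀ := by positivity
  have hS1 : 0 ≤ |M₁| * Ct₀ := by positivity
  have hS2 : 0 ≤ C₂ * Ct₂ := by positivity
  have hS3 : 0 ≤ C₃ * Ct₃ := by positivity
  refine ⟨min (kappa163 4 / (((3 : ℕ) : ℝ) + 1) / 4) (min (δ₂ / 4) (δ₃ / 4)), lt_min (by positivity) (lt_min (by positivity) (by positivity)),
    2 * S, by positivity, ?_⟩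
  set δ : ℝ := min (kappa163 4 / (((3 : ℕ) : ℝ) + 1) / 4) (min (δ₂ / 4) (δ₃ / 4)) with hδ_def
  have hδ₀ : δ ≤ kappa163 4 / (((3 : ℕ) : ℝ) + 1) / 4 := min_le_left _ _
  have hδ₂' : δ ≤ δ₂ / 4 := (min_le_right _ _).trans (min_le_left _ _)
  have hδ₃' : δ ≤ δ₃ / 4 := (min_le_right _ _).trans (min_le_right _ _)
  intro a₀ ε₂₉ Mc k K hMc hK a μ z R hc X hX β hβ hnear
  letI θ := thetaFill F a₀ ε₂₉; letI := θ.instVβ₁; letI := θ.instVβ₂; letI := θ.instιβ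
  -- RECORD BOOKKEEPING
  have hk' : k + 1 ≤ F.m + K := by unfold recordK₀ at hK; omega
  have hk : k + 1 ≤ (F.P K).m + (F.P K).K := by simpa only [T4Family.P_m, T4Family.P_K] using hk'
  have hk1 : k + 1 ≤ (F.P (K + 1)).m + (F.P (K + 1)).K := by simp only [T4Family.P_m, T4Family.P_K]; omega
  obtain ⟨hsh, hun, hus⟩ := stencil_commute_of_mem_domBonds hMc hK hX hβ
  have hρ : ‖fun i i' : Fin 2 => θ.ρ8 (θ.bV a) i i'‖ ≤ 1 := thetaFill_norm_ρ8_bV_le_one F a₀ ε₂₉ a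
  have hη0 : 0 ≤ (F.P K).eta (k + 1) := by unfold Params.eta; positivity
  have hLη : (((F.P K).L : ℝ) ^ (k + 1))⁻¹ = (F.P K).eta (k + 1) := by unfold Params.eta; rw [inv_pow]
  -- the tails' exponent against `δ·N_K`
  set t : ℕ := (F.P K).sitesPerDir (k + 1) with ht_def
  have ht0 : (0 : ℝ) ≤ t := Nat.cast_nonneg _
  have e₀ : Real.exp (-(kappa163 4 / (((3 : ℕ) : ℝ) + 1) * t / 4)) ≤ Real.exp (-(δ * (t : ℝ))) :=
    Real.exp_le_exp.2 (by nlinarith [mul_le_mul_of_nonneg_right hδ₀ ht0])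
  have e₂ : Real.exp (-(δ₂ * t / 4)) ≤ Real.exp (-(δ * (t : ℝ))) := Real.exp_le_exp.2 (by nlinarith [mul_le_mul_of_nonneg_right hδ₂' ht0])
  have e₃ : Real.exp (-(δ₃ * t / 4)) ≤ Real.exp (-(δ * (t : ℝ))) := Real.exp_le_exp.2 (by nlinarith [mul_le_mul_of_nonneg_right hδ₃' ht0])
  -- INTEGER COORDINATES of the bond's source, presenting it in BOTH volumes
  obtain ⟨r, hr_def⟩ : ∃ r : Fin (3 + 1) → ℤ, r = fun i => ((β.src (Fin.cast (F.P_d K).symm i)).valMinAbs : ℤ) := ⟨_, rfl⟩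
  have hxr : siteOfInt F K 0 r = β.src := by rw [hr_def]; exact siteOfInt_valMinAbs F K 0 β.src
  have hx'r : liftSiteCtr F K 0 β.src = siteOfInt F (K + 1) 0 r := by rw [hr_def]; exact liftSiteCtr_eq_siteOfInt F K 0 β.src
  have hr2 : ∀ i, 2 * |r i| ≤ ((F.P K).sitesPerDir 0 : ℤ) := by intro i; rw [hr_def]; exact two_mul_abs_valMinAbs_le F K 0 β.src _
  have hrK : toT (d := 3 + 1) (fine (d := 3 + 1) ((F.P K).L ^ (k + 1)) (Mk (F.P K) (k + 1))) r = EK hk β.src := by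
    rw [← EK_siteOfInt_eq_toT F hk r, hxr]
  have hrK1 : toT (d := 3 + 1) (fine (d := 3 + 1) ((F.P (K + 1)).L ^ (k + 1)) (Mk (F.P (K + 1)) (k + 1))) r = EK hk1 (liftSiteCtr F K 0 β.src) := by
    rw [← EK_siteOfInt_eq_toT F hk1 r, ← hx'r]
  -- THE LABELS: same `λ`, label sites `Φ_K(−z)`, `Φ_{K+1}(−z)`; `rep + z` is a period in each volume
  have hw : ∀ i, ((Mk (F.P K) (k + 1) i : ℕ) : ℤ) ∣ (rep (d := 3 + 1) (Mk (F.P K) (k + 1)) (siteOfInt F K (k + 1) (-z)) + z) i :=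
    fun i => isPeriod_rep_siteOfInt_neg_add F z i
  have hw' : ∀ i, ((Mk (F.P (K + 1)) (k + 1) i : ℕ) : ℤ) ∣ (rep (d := 3 + 1) (Mk (F.P (K + 1)) (k + 1)) (siteOfInt F (K + 1) (k + 1) (-z)) + z) i :=
    fun i => isPeriod_rep_siteOfInt_neg_add F z i
  have ht1 : 1 ≤ t := Nat.one_le_iff_ne_zero.2 ((F.P K).sitesPerDir_ne_zero (k + 1))
  have ht : ∀ i, t ≤ Mk (F.P K) (k + 1) i := fun _ => le_rfl
  have ht' : ∀ i, t ≤ Mk (F.P (K + 1)) (k + 1) i := fun _ => sitesPerDir_le_succ_vol F K (k + 1) hk'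
  -- NEAR″ CENTREDNESS: `2|blk r + z|_i ≤ 2R < N_K ≤ N_{K+1}`
  have hmem : iterBlockOf (k + 1) (siteOfInt F K 0 r) ∈ recordWindow F k K R (-z) := by rw [hxr, ← coarsenTo_eq_iterBlockOf]; exact hnear
  have hR : ∀ i, |(blk ((F.P K).L ^ (k + 1)) r + z) i| ≤ R := abs_blk_add_le_of_mem_window F hk R z hc r hr2 hmem
  have h2R : 2 * (R : ℤ) < t := by have h := hc 0; have h' := abs_nonneg ((-z) 0); rw [ht_def]; linarith
  have hNN : ((t : ℕ) : ℤ) ≤ (F.P (K + 1)).sitesPerDir (k + 1) := by rw [ht_def]; exact_mod_cast sitesPerDir_le_succ_vol F K (k + 1) hk'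
  have hx : ∀ i, 2 * |(blk ((F.P K).L ^ (k + 1)) r + z) i| ≤ ((Mk (F.P K) (k + 1) i : ℕ) : ℤ) := fun i => by
    show 2 * |(blk ((F.P K).L ^ (k + 1)) r + z) i| ≤ (((F.P K).sitesPerDir (k + 1) : ℕ) : ℤ); rw [← ht_def]; linarith [hR i]
  have hx' : ∀ i, 2 * |(blk ((F.P K).L ^ (k + 1)) r + z) i| ≤ ((Mk (F.P (K + 1)) (k + 1) i : ℕ) : ℤ) := fun i => by
    show 2 * |(blk ((F.P K).L ^ (k + 1)) r + z) i| ≤ (((F.P (K + 1)).sitesPerDir (k + 1) : ℕ) : ℤ); linarith [hR i, hNN]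
  -- §1: the four stencils of `E` factor through the scalar response
  obtain ⟨iV, iD, iL, iC⟩ := stencilE_eq_smul F a₀ ε₂₉ a (recordE F k K μ z) (recordE F k (K + 1) μ z) β.src β.dir hsh hun hus
  -- THE TWO-VOLUME PRESENTATIONS (file 2b at `K` and at `K + 1`, the latter restated over `n = L^{k+1}` of the family and the common `λ`)
  have hV : windowResp F k K Finset.univ (recordE F k K μ z) ⟨β.src, β.dir⟩ =
      (∑' m : Fin (3 + 1) → ℤ, imgKer ((F.P K).L ^ (k + 1)) β.dir (Fin.cast (F.P_d K).symm μ)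
        (translate (fine (d := 3 + 1) ((F.P K).L ^ (k + 1)) (Mk (F.P K) (k + 1)))
          (r - (((F.P K).L ^ (k + 1) : ℕ) : ℤ) • rep (d := 3 + 1) (Mk (F.P K) (k + 1)) (siteOfInt F K (k + 1) (-z))) m)).re := by
    have h := windowResp_univ_eq_re_tsum F hk (Fin.cast (F.P_d K).symm μ) (siteOfInt F K (k + 1) (-z)) β.src β.dir r 0 (by rw [add_zero]; exact hrK)
    rw [add_zero] at h
    exact h
  have hV' : windowResp F k (K + 1) Finset.univ (recordE F k (K + 1) μ z) ⟨liftSiteCtr F K 0 β.src, β.dir⟩ =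
      (∑' m : Fin (3 + 1) → ℤ, imgKer ((F.P K).L ^ (k + 1)) β.dir (Fin.cast (F.P_d K).symm μ)
        (translate (fine (d := 3 + 1) ((F.P K).L ^ (k + 1)) (Mk (F.P (K + 1)) (k + 1)))
          (r - (((F.P K).L ^ (k + 1) : ℕ) : ℤ) • rep (d := 3 + 1) (Mk (F.P (K + 1)) (k + 1)) (siteOfInt F (K + 1) (k + 1) (-z))) m)).re := by
    have h := windowResp_univ_eq_re_tsum F hk1 (Fin.cast (F.P_d (K + 1)).symm μ) (siteOfInt F (K + 1) (k + 1) (-z)) (liftSiteCtr F K 0 β.src) β.dir r 0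
      (by rw [add_zero]; exact hrK1)
    rw [add_zero] at h
    exact h
  have hD : ∀ ν : Fin (F.P K).d, windowResp F k K Finset.univ (recordE F k K μ z) ⟨β.src.shift ν, β.dir⟩ - windowResp F k K Finset.univ (recordE F k K μ z) ⟨β.src, β.dir⟩ =
      (∑' m : Fin (3 + 1) → ℤ, kerDiff ((F.P K).L ^ (k + 1)) β.dir (Fin.cast (F.P_d K).symm μ) ν
        (translate (fine (d := 3 + 1) ((F.P K).L ^ (k + 1)) (Mk (F.P K) (k + 1)))
          (r - (((F.P K).L ^ (k + 1) : ℕ) : ℤ) • rep (d := 3 + 1) (Mk (F.P K) (k + 1)) (siteOfInt F K (k + 1) (-z))) m)).re := fun ν => by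
    exact diffStencil_windowResp_univ_eq F hk (Fin.cast (F.P_d K).symm μ) (siteOfInt F K (k + 1) (-z)) β.src β.dir ν r hrK
  have hD' : ∀ ν : Fin (F.P K).d, windowResp F k (K + 1) Finset.univ (recordE F k (K + 1) μ z) ⟨(liftSiteCtr F K 0 β.src).shift ν, β.dir⟩ -
      windowResp F k (K + 1) Finset.univ (recordE F k (K + 1) μ z) ⟨liftSiteCtr F K 0 β.src, β.dir⟩ =
      (∑' m : Fin (3 + 1) → ℤ, kerDiff ((F.P K).L ^ (k + 1)) β.dir (Fin.cast (F.P_d K).symm μ) ν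
        (translate (fine (d := 3 + 1) ((F.P K).L ^ (k + 1)) (Mk (F.P (K + 1)) (k + 1)))
          (r - (((F.P K).L ^ (k + 1) : ℕ) : ℤ) • rep (d := 3 + 1) (Mk (F.P (K + 1)) (k + 1)) (siteOfInt F (K + 1) (k + 1) (-z))) m)).re := fun ν => by
    exact diffStencil_windowResp_univ_eq F hk1 (Fin.cast (F.P_d (K + 1)).symm μ) (siteOfInt F (K + 1) (k + 1) (-z)) (liftSiteCtr F K 0 β.src) β.dir ν r hrK1
  have hL : (∑ ν : Fin (F.P K).d, (windowResp F k K Finset.univ (recordE F k K μ z) ⟨β.src.shift ν, β.dir⟩ -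
      2 * windowResp F k K Finset.univ (recordE F k K μ z) ⟨β.src, β.dir⟩ + windowResp F k K Finset.univ (recordE F k K μ z) ⟨β.src.unshift ν, β.dir⟩)) =
      (∑' m : Fin (3 + 1) → ℤ, kerLap ((F.P K).L ^ (k + 1)) β.dir (Fin.cast (F.P_d K).symm μ)
        (translate (fine (d := 3 + 1) ((F.P K).L ^ (k + 1)) (Mk (F.P K) (k + 1)))
          (r - (((F.P K).L ^ (k + 1) : ℕ) : ℤ) • rep (d := 3 + 1) (Mk (F.P K) (k + 1)) (siteOfInt F K (k + 1) (-z))) m)).re := by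
    exact lapStencil_windowResp_univ_eq F hk (Fin.cast (F.P_d K).symm μ) (siteOfInt F K (k + 1) (-z)) β.src β.dir r hrK
  have hL' : (∑ ν : Fin (F.P K).d, (windowResp F k (K + 1) Finset.univ (recordE F k (K + 1) μ z) ⟨(liftSiteCtr F K 0 β.src).shift ν, β.dir⟩ -
      2 * windowResp F k (K + 1) Finset.univ (recordE F k (K + 1) μ z) ⟨liftSiteCtr F K 0 β.src, β.dir⟩ +
      windowResp F k (K + 1) Finset.univ (recordE F k (K + 1) μ z) ⟨(liftSiteCtr F K 0 β.src).unshift ν, β.dir⟩)) =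
      (∑' m : Fin (3 + 1) → ℤ, kerLap ((F.P K).L ^ (k + 1)) β.dir (Fin.cast (F.P_d K).symm μ)
        (translate (fine (d := 3 + 1) ((F.P K).L ^ (k + 1)) (Mk (F.P (K + 1)) (k + 1)))
          (r - (((F.P K).L ^ (k + 1) : ℕ) : ℤ) • rep (d := 3 + 1) (Mk (F.P (K + 1)) (k + 1)) (siteOfInt F (K + 1) (k + 1) (-z))) m)).re := by
    exact lapStencil_windowResp_univ_eq F hk1 (Fin.cast (F.P_d (K + 1)).symm μ) (siteOfInt F (K + 1) (k + 1) (-z)) (liftSiteCtr F K 0 β.src) β.dir r hrK1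
  have hC : (letI W : PBond (F.P K) 0 → ℝ := windowResp F k K Finset.univ (recordE F k K μ z)
      ∑ ν : Fin (F.P K).d, ((W ⟨β.src, β.dir⟩ + W ⟨β.src.shift β.dir, ν⟩ - W ⟨β.src.shift ν, β.dir⟩ - W ⟨β.src, ν⟩) -
        (W ⟨β.src.unshift ν, β.dir⟩ + W ⟨(β.src.unshift ν).shift β.dir, ν⟩ - W ⟨(β.src.unshift ν).shift ν, β.dir⟩ - W ⟨β.src.unshift ν, ν⟩))) =
      (∑' m : Fin (3 + 1) → ℤ, kerCurl ((F.P K).L ^ (k + 1)) β.dir (Fin.cast (F.P_d K).symm μ)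
        (translate (fine (d := 3 + 1) ((F.P K).L ^ (k + 1)) (Mk (F.P K) (k + 1)))
          (r - (((F.P K).L ^ (k + 1) : ℕ) : ℤ) • rep (d := 3 + 1) (Mk (F.P K) (k + 1)) (siteOfInt F K (k + 1) (-z))) m)).re := by
    exact curlStencil_windowResp_univ_eq F hk (Fin.cast (F.P_d K).symm μ) (siteOfInt F K (k + 1) (-z)) β.src β.dir r hrK
  have hC' : (letI W' : PBond (F.P (K + 1)) 0 → ℝ := windowResp F k (K + 1) Finset.univ (recordE F k (K + 1) μ z)
      letI x' : Site (F.P (K + 1)) 0 := liftSiteCtr F K 0 β.src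
      ∑ ν : Fin (F.P K).d, ((W' ⟨x', β.dir⟩ + W' ⟨x'.shift β.dir, ν⟩ - W' ⟨x'.shift ν, β.dir⟩ - W' ⟨x', ν⟩) -
        (W' ⟨x'.unshift ν, β.dir⟩ + W' ⟨(x'.unshift ν).shift β.dir, ν⟩ - W' ⟨(x'.unshift ν).shift ν, β.dir⟩ - W' ⟨x'.unshift ν, ν⟩))) =
      (∑' m : Fin (3 + 1) → ℤ, kerCurl ((F.P K).L ^ (k + 1)) β.dir (Fin.cast (F.P_d K).symm μ)
        (translate (fine (d := 3 + 1) ((F.P K).L ^ (k + 1)) (Mk (F.P (K + 1)) (k + 1)))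
          (r - (((F.P K).L ^ (k + 1) : ℕ) : ℤ) • rep (d := 3 + 1) (Mk (F.P (K + 1)) (k + 1)) (siteOfInt F (K + 1) (k + 1) (-z))) m)).re := by
    exact curlStencil_windowResp_univ_eq F hk1 (Fin.cast (F.P_d (K + 1)).symm μ) (siteOfInt F (K + 1) (k + 1) (-z)) (liftSiteCtr F K 0 β.src) β.dir r hrK1
  -- THE INFINITE-VOLUME ROWS at the offset of `r` (file 3), and offset-form summability (§2)
  have gV : ∀ z' : Fin (3 + 1) → ℤ, ‖(((imgKer ((F.P K).L ^ (k + 1)) β.dir (Fin.cast (F.P_d K).symm μ)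
      ((fun j => ((off ((F.P K).L ^ (k + 1)) r j : ℕ) : ℤ)) + (((F.P K).L ^ (k + 1) : ℕ) : ℤ) • z')).re : ℝ) : ℂ)‖ ≤
      |M₀| * Real.exp (-(kappa163 4 / (((3 : ℕ) : ℝ) + 1) * supNorm z')) := fun z' =>
    (norm_re_imgKer_le K k (off ((F.P K).L ^ (k + 1)) r) β.dir (Fin.cast (F.P_d K).symm μ) z').trans
      (mul_le_mul_of_nonneg_right (le_abs_self _) (Real.exp_pos _).le)
  have gD : ∀ (ν : Fin (F.P K).d) (z' : Fin (3 + 1) → ℤ), ‖(((kerDiff ((F.P K).L ^ (k + 1)) β.dir (Fin.cast (F.P_d K).symm μ) ν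
      ((fun j => ((off ((F.P K).L ^ (k + 1)) r j : ℕ) : ℤ)) + (((F.P K).L ^ (k + 1) : ℕ) : ℤ) • z')).re : ℝ) : ℂ)‖ ≤
      ((F.P K).eta (k + 1) * |M₁|) * Real.exp (-(kappa163 4 / (((3 : ℕ) : ℝ) + 1) * supNorm z')) := fun ν z' => by
    have h := norm_re_kerDiff_le F K k (off ((F.P K).L ^ (k + 1)) r) β.dir (Fin.cast (F.P_d K).symm μ) ν z'
    rw [hLη] at h
    refine h.trans ?_
    have h1 : M₁ * Real.exp (-(kappa163 4 / (((3 : ℕ) : ℝ) + 1) * supNorm z')) ≤ |M₁| * Real.exp (-(kappa163 4 / (((3 : ℕ) : ℝ) + 1) * supNorm z')) :=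
      mul_le_mul_of_nonneg_right (le_abs_self _) (Real.exp_pos _).le
    calc (F.P K).eta (k + 1) * (M₁ * Real.exp (-(kappa163 4 / (((3 : ℕ) : ℝ) + 1) * supNorm z')))
        ≤ (F.P K).eta (k + 1) * (|M₁| * Real.exp (-(kappa163 4 / (((3 : ℕ) : ℝ) + 1) * supNorm z'))) := mul_le_mul_of_nonneg_left h1 hη0
      _ = (F.P K).eta (k + 1) * |M₁| * Real.exp (-(kappa163 4 / (((3 : ℕ) : ℝ) + 1) * supNorm z')) := (mul_assoc _ _ _).symm
  have gL : ∀ z' : Fin (3 + 1) → ℤ, ‖(((kerLap ((F.P K).L ^ (k + 1)) β.dir (Fin.cast (F.P_d K).symm μ)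
      ((fun j => ((off ((F.P K).L ^ (k + 1)) r j : ℕ) : ℤ)) + (((F.P K).L ^ (k + 1) : ℕ) : ℤ) • z')).re : ℝ) : ℂ)‖ ≤
      (C₂ * (F.P K).eta (k + 1) ^ 2) * Real.exp (-(δ₂ * supNorm z')) := fun z' => hLap K k (off ((F.P K).L ^ (k + 1)) r) β.dir (Fin.cast (F.P_d K).symm μ) z'
  have gC : ∀ z' : Fin (3 + 1) → ℤ, ‖(((kerCurl ((F.P K).L ^ (k + 1)) β.dir (Fin.cast (F.P_d K).symm μ)
      ((fun j => ((off ((F.P K).L ^ (k + 1)) r j : ℕ) : ℤ)) + (((F.P K).L ^ (k + 1) : ℕ) : ℤ) • z')).re : ℝ) : ℂ)‖ ≤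
      (C₃ * (F.P K).eta (k + 1) ^ 2) * Real.exp (-(δ₃ * supNorm z')) := fun z' => hCurl K k (off ((F.P K).L ^ (k + 1)) r) β.dir (Fin.cast (F.P_d K).symm μ) z'
  have sV := fun (N : Fin (3 + 1) → ℕ) (hN : ∀ i, 1 ≤ N i) (x : Fin (3 + 1) → ℤ) =>
    summable_imgKer_offset ((F.P K).L ^ (k + 1)) hN β.dir (Fin.cast (F.P_d K).symm μ) (off ((F.P K).L ^ (k + 1)) r) x
  have sD := fun (ν : Fin (F.P K).d) (N : Fin (3 + 1) → ℕ) (hN : ∀ i, 1 ≤ N i) (x : Fin (3 + 1) → ℤ) =>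
    summable_kerDiff_offset ((F.P K).L ^ (k + 1)) hN β.dir (Fin.cast (F.P_d K).symm μ) ν (off ((F.P K).L ^ (k + 1)) r) x
  have sL := fun (N : Fin (3 + 1) → ℕ) (hN : ∀ i, 1 ≤ N i) (x : Fin (3 + 1) → ℤ) =>
    summable_kerLap_offset ((F.P K).L ^ (k + 1)) hN β.dir (Fin.cast (F.P_d K).symm μ) (off ((F.P K).L ^ (k + 1)) r) x
  have sC := fun (N : Fin (3 + 1) → ℕ) (hN : ∀ i, 1 ≤ N i) (x : Fin (3 + 1) → ℤ) =>
    summable_kerCurl_offset ((F.P K).L ^ (k + 1)) hN β.dir (Fin.cast (F.P_d K).symm μ) (off ((F.P K).L ^ (k + 1)) r) x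
  -- THE FOUR TWO-VOLUME TAIL BOUNDS (file 4a)
  have TV := abs_re_periodise_sub_le hCt₀ ((F.P K).L ^ (k + 1)) _ r gV sV (Mk (F.P K) (k + 1)) (Mk (F.P (K + 1)) (k + 1)) _ _ z hw hw' t ht1 ht ht' hx hx'
  have TD := fun ν : Fin (F.P K).d =>
    abs_re_periodise_sub_le hCt₀ ((F.P K).L ^ (k + 1)) _ r (gD ν) (sD ν) (Mk (F.P K) (k + 1)) (Mk (F.P (K + 1)) (k + 1)) _ _ z hw hw' t ht1 ht ht' hx hx'
  have TL := abs_re_periodise_sub_le hCt₂ ((F.P K).L ^ (k + 1)) _ r gL sL (Mk (F.P K) (k + 1)) (Mk (F.P (K + 1)) (k + 1)) _ _ z hw hw' t ht1 ht ht' hx hx'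
  have TC := abs_re_periodise_sub_le hCt₃ ((F.P K).L ^ (k + 1)) _ r gC sC (Mk (F.P K) (k + 1)) (Mk (F.P (K + 1)) (k + 1)) _ _ z hw hw' t ht1 ht ht' hx hx'
  rw [← hV, ← hV'] at TV
  rw [← hL, ← hL'] at TL
  rw [← hC, ← hC'] at TC
  -- ASSEMBLY
  have hm0 : |M₀| * Ct₀ ≤ S := by rw [hS_def]; linarith
  have hm1 : |M₁| * Ct₀ ≤ S := by rw [hS_def]; linarith
  have hm2 : C₂ * Ct₂ ≤ S := by rw [hS_def]; linarith
  have hm3 : C₃ * Ct₃ ≤ S := by rw [hS_def]; linarith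
  refine ⟨(le_of_eq (congrArg _ iV)).trans ((norm_real_smul_le hρ).trans ?_),
    fun ν => (le_of_eq (congrArg _ (iD ν))).trans ((norm_real_smul_le hρ).trans ?_),
    (le_of_eq (congrArg _ iL)).trans ((norm_real_smul_le hρ).trans ?_),
    (le_of_eq (congrArg _ iC)).trans ((norm_real_smul_le hρ).trans ?_)⟩
  · rw [abs_mul, abs_of_nonneg hη0, abs_sub_comm]
    refine (mul_le_mul_of_nonneg_left TV hη0).trans ?_
    exact clause_arith hη0 hm0 hS0 e₀ (Real.exp_pos _).le
  · have TDν := TD ν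
    rw [← hD ν, ← hD' ν] at TDν
    rw [abs_mul, abs_of_nonneg hη0, abs_sub_comm]
    refine (mul_le_mul_of_nonneg_left TDν hη0).trans ?_
    have h := clause_arith hη0 hm1 hS1 e₀ (Real.exp_pos _).le (ξ := (F.P K).eta (k + 1))
    calc (F.P K).eta (k + 1) * (2 * ((F.P K).eta (k + 1) * |M₁| * Ct₀ * Real.exp (-(kappa163 4 / (((3 : ℕ) : ℝ) + 1) * t / 4))))
        = (F.P K).eta (k + 1) * ((F.P K).eta (k + 1) * (2 * (|M₁| * Ct₀ * Real.exp (-(kappa163 4 / (((3 : ℕ) : ℝ) + 1) * t / 4))))) := by ring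
      _ ≤ (F.P K).eta (k + 1) * (2 * S * Real.exp (-(δ * (t : ℝ))) * (F.P K).eta (k + 1)) := mul_le_mul_of_nonneg_left h hη0
      _ = 2 * S * Real.exp (-(δ * (t : ℝ))) * (F.P K).eta (k + 1) ^ 2 := by ring
  · rw [abs_mul, abs_of_nonneg hη0, abs_sub_comm]
    refine (mul_le_mul_of_nonneg_left TL hη0).trans ?_
    have h := clause_arith hη0 hm2 hS2 e₂ (Real.exp_pos _).le (ξ := (F.P K).eta (k + 1))
    calc (F.P K).eta (k + 1) * (2 * (C₂ * (F.P K).eta (k + 1) ^ 2 * Ct₂ * Real.exp (-(δ₂ * t / 4))))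
        = (F.P K).eta (k + 1) ^ 2 * ((F.P K).eta (k + 1) * (2 * (C₂ * Ct₂ * Real.exp (-(δ₂ * t / 4))))) := by ring
      _ ≤ (F.P K).eta (k + 1) ^ 2 * (2 * S * Real.exp (-(δ * (t : ℝ))) * (F.P K).eta (k + 1)) := mul_le_mul_of_nonneg_left h (pow_nonneg hη0 2)
      _ = 2 * S * Real.exp (-(δ * (t : ℝ))) * (F.P K).eta (k + 1) ^ 3 := by ring
  · rw [abs_mul, abs_of_nonneg hη0, abs_sub_comm]
    refine (mul_le_mul_of_nonneg_left TC hη0).trans ?_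
    have h := clause_arith hη0 hm3 hS3 e₃ (Real.exp_pos _).le (ξ := (F.P K).eta (k + 1))
    calc (F.P K).eta (k + 1) * (2 * (C₃ * (F.P K).eta (k + 1) ^ 2 * Ct₃ * Real.exp (-(δ₃ * t / 4))))
        = (F.P K).eta (k + 1) ^ 2 * ((F.P K).eta (k + 1) * (2 * (C₃ * Ct₃ * Real.exp (-(δ₃ * t / 4))))) := by ring
      _ ≤ (F.P K).eta (k + 1) ^ 2 * (2 * S * Real.exp (-(δ * (t : ℝ))) * (F.P K).eta (k + 1)) := mul_le_mul_of_nonneg_left h (pow_nonneg hη0 2)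
      _ = 2 * S * Real.exp (-(δ * (t : ℝ))) * (F.P K).eta (k + 1) ^ 3 := by ring

end Summit.QuantumFields.YangMills.Theorems.PortU8.Images

end
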